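import Literature.Probability.LatticeModels.PlaneRotatorHelicityModulus
import Literature.Probability.LatticeModels.GinibreCharacterExpansion
import Mathlib.Analysis.Calculus.DerivativeTest
import Mathlib.Analysis.SpecialFunctions.Trigonometric.Bounds
import HarnessLib

/-!
# Ginibre's twist inequality `Z(J, u) ≤ Z(J, 1)` for the ferromagnetic plane rotator with bond
# phases, the finite-twist free-energy window `0 ≤ log Z(0) − log Z(t) ≤ (t²/2)·(f-sum)`, and the
# sign of the helicity modulus: `0 ≤ βΥ_L(K) ≤ 8K²/(1 + 8K)` on `(ℤ/Lℤ)²`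

Topic `Literature/Probability/LatticeModels`; pure-proof companion of
`PlaneRotatorHelicityModulus.lean` (the finite-volume helicity modulus `twistModulus`,
`torusXYStiffness`) and `GinibreCharacterExpansion.lean` (the character expansion of Ginibre models).
Everything here is PROVED; no definition and no named fact is introduced.

For a generalised plane rotator on a compact abelian group `Ω` (Haar probability measure `μ`,
interaction characters `χ_a : Ω → U(1)`, couplings `J_a`) we put a **phase** `u_a ∈ U(1)` on every
interaction term — the weight `exp(∑_a J_a Re(u_a χ_a(θ)))`; on the torus `U(1)^V` with the bond
characters of a bond system these are the quenched bond phases of Garban–Spencer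
(`BondSystem.weight β u`, `DisorderedXYModel.lean`) and, for `u_a = e^{i t s_a}`, the twisted
ensemble of Fisher–Barber–Jasnow (`BondSystem.twistWeight J s t`, `PlaneRotatorHelicityModulus.lean`).

## Contents

* §1 **Character expansion with phases** (`integral_coe_char_mul_phasedWeight`):
  `∫ χ₀(θ) exp(∑_a J_a Re(u_a χ_a(θ))) dμ = ∑_{n ∈ ℤ^ι} [χ₀ ∏_a χ_a^{n_a} = 1] ∏_a I_{n_a}(J_a) u_a^{n_a}`,
  from `e^{x Re z} = ∑_m I_m(x) z^m` on the unit circle (tree `hasSum_besselI_mul_zpow`) at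
  `z = u_a χ_a(θ)` and the tree's term-by-term integration `integral_coe_char_mul_prod_tsum`.
* §2 **Ginibre's twist inequality**: for ferromagnetic couplings `J ≥ 0` all dual weights
  `∏_a I_{n_a}(J_a)` are `≥ 0`, so `u ↦ ∫ χ₀ w_{J,u}` is a positive combination of characters of
  `U(1)^ι` and is bounded in modulus by its value at `u = 1`:
  `|∫ χ₀(θ) exp(∑_a J_a Re(u_a χ_a(θ))) dμ| ≤ ∫ Re χ₀ · exp(∑_a J_a Re χ_a) dμ`
  (`norm_integral_coe_char_mul_phasedWeight_le`; Ginibre 1970, §2 Examples 2 and 4: the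
  positive-definite functions on a compact abelian group form a multiplicative cone and a
  positive-definite function is bounded by its value at the identity), in particular for the
  partition functions `∫ exp(∑_a J_a Re(u_a χ_a)) dμ ≤ ∫ exp(∑_a J_a Re χ_a) dμ`
  (`integral_phasedWeight_le`). By-product: **Griffiths' first inequality** `0 ≤ ⟨Re χ₀⟩_J` on ANY
  compact abelian group for `J ≥ 0`, read off the dual sum (`ginibreExpect_reChar_nonneg_dual`; the
  tree's `torus_ginibreExpect_reChar_nonneg` assumes square roots in the group).
* §3 The three vocabularies of the tree on the torus `U(1)^V`:
  `BondSystem.partitionFn_le_partitionFn_one` (`Z_{β,u} ≤ Z_{β,1}`: quenched bond phases never raise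
  the partition function of the ferromagnetic XY model), `BondSystem.twistPartitionFn_le`
  (`Z(t) ≤ Z(0)`: a twist costs free energy, `log_twistPartitionFn_le`), the complex form of the
  twisted partition function as a sum over closed integer bond currents with phases `e^{i t s_a n_a}`
  (`BondSystem.coe_twistPartitionFn_eq_tsum`), and `BondSystem.expectJ_reChar_nonneg` (Griffiths'
  first inequality with general ferromagnetic bond couplings, any character).
* §4 **Finite twists** (any real couplings unless stated): Jensen's inequality in the plane-rotator
  state (`exp_expectJ_mul_partitionFnJ_le`, `e^{⟨X⟩_J} Z(J) ≤ ∫ e^X w_J`) applied to `X = H_t − H_0`,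
  whose mean is `−∑_a J_a (1 − cos(t s_a)) ⟨cos ∇θ_a⟩_J` (`expectJ_twistHamiltonian_sub`; the `sin`
  terms average to zero), gives `log Z(0) − log Z(t) ≤ ∑_a J_a (1 − cos(t s_a)) ⟨cos ∇θ_a⟩_J`
  (`log_twistPartitionFn_zero_sub_le`); with §3 and `1 − cos x ≤ x²/2`, for `J ≥ 0`:
  **`0 ≤ log Z(0) − log Z(t) ≤ (t²/2) ∑_a J_a s_a² ⟨cos ∇θ_a⟩_J`** (`log_twistPartitionFn_zero_sub_mem_Icc`)
  — the free-energy cost of a FINITE twist lies between zero and the f-sum; `Z(−t) = Z(t)`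
  (`twistPartitionFn_neg`).
* §5 **The helicity modulus is nonnegative** (`BondSystem.twistModulus_nonneg`, `J ≥ 0`): `t = 0`
  is a global minimum of the `C²` function `t ↦ −log Z(t)` whose second derivative at `0` is
  `twistModulus` (tree `iteratedDeriv_two_negLog_twistPartitionFn`), so `twistModulus ≥ 0` by the
  second-derivative test (a strict negative sign would make `0` a local maximum, hence `−log Z`
  locally constant, hence the second derivative zero). Corollaries: the current fluctuations never
  exceed the f-sum, `⟨𝒥_s²⟩_J ≤ ∑_a J_a s_a² ⟨cos ∇θ_a⟩_J` (`expectJ_twistCurrent_sq_le_energy`), and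
  `0 ≤ twistModulus ≤ ∑_a J_a s_a²` (`twistModulus_mem_Icc`).
* §6 The torus `(ℤ/Lℤ)²`: **`0 ≤ βΥ_L(K) ≤ 8K²/(1 + 8K)`** for `L ≥ 3`, `K > 0`
  (`torusXYStiffness_nonneg`, `torusXYStiffness_mem_Icc`; the ceiling is the tree's
  `torusXYStiffness_le`), `0 ≤ Υ_L(T) ≤ 8J²/(T + 8J)` in temperature units
  (`mul_torusXYStiffness_mem_Icc`), and the per-site finite-twist window
  `0 ≤ (log Z_L(K;0) − log Z_L(K;t))/L² ≤ (t²/2)·8K²/(1 + 8K)`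
  (`torusXY_log_twistPartitionFn_sub_div_card_mem_Icc`).

Reading (cell `pub/hubbard-tc`): the finite-volume stiffness window of the classical XY model is now
two-sided in the kernel; a stiffness-window hypothesis `Υ_L/J ≥ y₀ > 0` (the typing rule for
`Υ_L`-renormalised decay statements, `torusXY_not_uniform_decay_of_tendsto`) sits inside the proved
range `[0, 8K/(1 + 8K)]`.

## What this is not

Not positivity of the infinite-volume helicity modulus at low temperature (Fröhlich–Spencer), not its
jump at the transition (Chayes 1998), nothing about vortices or about any quantum or electronic model;
no number of the cell's tables consumes this file. A classical comparison-model statement.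

## References

* J. Ginibre, *General formulation of Griffiths' inequalities*, Comm. Math. Phys. 16 (1970) 310–328,
  §2 Examples 2 and 4 (positive-definite functions on a compact abelian group; «φ_f is bounded
  everywhere by its value at the origin», p. 318) and Model 3 (plane rotators). [Ginibre1970]
* M. E. Fisher, M. N. Barber, D. Jasnow, Phys. Rev. A 8 (1973) 1111, §II eqs. (2.3)–(2.5) (twisted
  ensemble, helicity modulus). [FisherBarberJasnow1973]
* C. Garban, T. Spencer, J. Math. Phys. 63 (2022) 093302, (1.3)–(1.4) (bond phases) and Appendix
  Thm 21 (the Messager–Miracle-Solé–Pfister comparison of correlations, tree `MMPInequality.lean`;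
  here the partition-function companion). [GarbanSpencer2022]
* I. Montvay, G. Münster, *Quantum Fields on a Lattice*, CUP 1994, §3.2.7 (3.169)–(3.172)
  (character expansion, `I_n ≥ 0`). [MontvayMunster1994]
* J. Fröhlich, T. Spencer, Comm. Math. Phys. 83 (1982) 411, §2.3 (duality transformation).
  [FrohlichSpencerCMP1982]
* S. Friedli, Y. Velenik, *Statistical Mechanics of Lattice Systems*, CUP 2017, §3.10.2, proof of
  Thm 3.53 (Jensen / Peierls–Bogoliubov `Z ≥ Z⁰ e^{−⟨H¹⟩⁰}`). [FriedliVelenik2017]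

Tree: `besselI`, `hasSum_besselI_mul_zpow`, `twistChar`, `integral_coe_char_mul_prod_tsum`,
`summable_prod_norm`, `integral_reChar_mul_ginibreWeight`, `BondSystem.weight/partitionFn`,
`BondSystem.twistWeight/twistPartitionFn/twistModulus/twistFreeEnergyDeriv`, `torusXYStiffness(_le)`.
Mathlib: `isLocalMax_of_deriv_deriv_neg`, `Filter.EventuallyEq.deriv`, `norm_tsum_le_tsum_norm`,
`Real.add_one_le_exp`, `Real.one_sub_sq_div_two_le_cos`, `integral_inv_eq_self`.
-/

noncomputable section

open MeasureTheory Finset Filter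
open scoped BigOperators Topology

namespace Literature.Probability.LatticeModels

/-! ## §1 The character expansion with phases -/

section Phased

variable {Ω : Type*} [CommGroup Ω] [TopologicalSpace Ω] {ι : Type*} [Fintype ι]

/-- The generating identity with a phase: `e^{x Re(u z)} = ∑_{m ∈ ℤ} (I_m(x) u^m) z^m` for
`u, z ∈ U(1)` — the Fourier coefficients of `θ ↦ e^{x cos(θ + ω)}` are `I_m(x) e^{imω}`.
[cite: MontvayMunster1994, §3.2.7 (3.171)–(3.172) (PDF p. 128)] -/
theorem hasSum_besselI_mul_phase_zpow (x : ℝ) (u z : Circle) :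
    HasSum (fun m : ℤ => ((besselI m x : ℂ) * (u : ℂ) ^ m) * (z : ℂ) ^ m)
      (Real.exp (x * ((u : ℂ) * (z : ℂ)).re) : ℂ) := by
  have h := hasSum_besselI_mul_zpow x (u * z)
  simp only [Circle.coe_mul, mul_zpow, ← mul_assoc] at h
  exact h

/-- `‖I_m(x) u^m‖ = |I_m(x)|` for a phase `u ∈ U(1)`. [cite: MontvayMunster1994, §3.2.7 (3.171)–(3.172) (PDF p. 128)] -/
theorem norm_besselI_mul_phase_zpow (x : ℝ) (u : Circle) (m : ℤ) :
    ‖(besselI m x : ℂ) * (u : ℂ) ^ m‖ = |besselI m x| := by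
  rw [norm_mul, norm_zpow, Circle.norm_coe, one_zpow, mul_one, Complex.norm_real, Real.norm_eq_abs]

/-- The phased coefficients `m ↦ I_m(x) u^m` are absolutely summable. [cite: MontvayMunster1994, §3.2.7 (3.171)–(3.172) (PDF p. 128)] -/
theorem summable_norm_besselI_mul_phase_zpow (x : ℝ) (u : Circle) :
    Summable fun m : ℤ => ‖(besselI m x : ℂ) * (u : ℂ) ^ m‖ := by
  simp_rw [norm_besselI_mul_phase_zpow]
  exact summable_abs_besselI x

/-- The phased weight is a product of Bessel character series:
`e^{∑_a J_a Re(u_a χ_a(θ))} = ∏_a ∑_m (I_m(J_a) u_a^m) χ_a(θ)^m`. [cite: MontvayMunster1994, §3.2.7 (3.171)–(3.172) (PDF p. 128)] -/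
theorem exp_sum_phase_eq_prod_tsum (χ : ι → Ω →ₜ* Circle) (J : ι → ℝ) (u : ι → Circle) (θ : Ω) :
    (Real.exp (∑ a, J a * ((u a : ℂ) * ((χ a θ : Circle) : ℂ)).re) : ℂ) =
      ∏ a, ∑' m : ℤ, ((besselI m (J a) : ℂ) * (u a : ℂ) ^ m) * ((χ a θ : Circle) : ℂ) ^ m := by
  rw [Real.exp_sum, Complex.ofReal_prod]
  refine Finset.prod_congr rfl fun a _ => ?_
  rw [(hasSum_besselI_mul_phase_zpow (J a) (u a) (χ a θ)).tsum_eq]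

variable [IsTopologicalGroup Ω] [MeasurableSpace Ω] [BorelSpace Ω]

open Classical in
/-- **Character expansion with phases**: for the normalised Haar measure of a compact abelian group,
characters `χ_a`, `χ₀`, real couplings `J_a` and phases `u_a ∈ U(1)`,
`∫ χ₀(θ) exp(∑_a J_a Re(u_a χ_a(θ))) dθ = ∑_{n ∈ ℤ^ι} [χ₀ ∏_a χ_a^{n_a} = 1] ∏_a I_{n_a}(J_a) u_a^{n_a}`
— the sum over integer currents `n` closing the source `χ₀`, each weighted by Bessel factors and
the phase `∏_a u_a^{n_a}`. [cite: FrohlichSpencerCMP1982, §2.3 (duality transformation); MontvayMunster1994 §3.2.7 (3.169)–(3.172)] -/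
theorem integral_coe_char_mul_phasedWeight (μ : Measure Ω) [μ.IsHaarMeasure]
    [IsProbabilityMeasure μ] (χ : ι → Ω →ₜ* Circle) (J : ι → ℝ) (u : ι → Circle)
    (χ₀ : Ω →ₜ* Circle) :
    ∫ θ, ((χ₀ θ : Circle) : ℂ) * (Real.exp (∑ a, J a * ((u a : ℂ) * ((χ a θ : Circle) : ℂ)).re) : ℂ) ∂μ =
      ∑' n : ι → ℤ, if twistChar χ χ₀ n = 1 then
        ∏ a, (besselI (n a) (J a) : ℂ) * (u a : ℂ) ^ (n a) else 0 := by
  simp_rw [exp_sum_phase_eq_prod_tsum]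
  exact integral_coe_char_mul_prod_tsum μ χ χ₀
    (c := fun a m => (besselI m (J a) : ℂ) * (u a : ℂ) ^ m)
    fun a => summable_norm_besselI_mul_phase_zpow (J a) (u a)

open Classical in
/-- The phased partition function in the dual variables (complex form):
`∫ exp(∑_a J_a Re(u_a χ_a(θ))) dθ = ∑_{n ∈ ℤ^ι} [∏_a χ_a^{n_a} = 1] ∏_a I_{n_a}(J_a) u_a^{n_a}`.
[cite: FrohlichSpencerCMP1982, §2.3 (duality transformation); MontvayMunster1994 §3.2.7 (3.169)–(3.172)] -/
theorem coe_integral_phasedWeight_eq_tsum (μ : Measure Ω) [μ.IsHaarMeasure]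
    [IsProbabilityMeasure μ] (χ : ι → Ω →ₜ* Circle) (J : ι → ℝ) (u : ι → Circle) :
    ((∫ θ, Real.exp (∑ a, J a * ((u a : ℂ) * ((χ a θ : Circle) : ℂ)).re) ∂μ : ℝ) : ℂ) =
      ∑' n : ι → ℤ, if twistChar χ 1 n = 1 then
        ∏ a, (besselI (n a) (J a) : ℂ) * (u a : ℂ) ^ (n a) else 0 := by
  rw [← integral_coe_char_mul_phasedWeight μ χ J u 1, ← integral_complex_ofReal]
  refine integral_congr_ae (ae_of_all _ fun θ => ?_)
  simp

/-! ## §2 Ginibre's twist inequality -/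

variable [CompactSpace Ω]

open Classical in
/-- **Ginibre's twist inequality, source form** (the unnormalised Messager–Miracle-Solé–Pfister
comparison): for FERROMAGNETIC couplings `J ≥ 0`, every character `χ₀` and all phases `u`,
`|∫ χ₀(θ) exp(∑_a J_a Re(u_a χ_a(θ))) dθ| ≤ ∫ Re χ₀(θ) exp(∑_a J_a Re χ_a(θ)) dθ`.
Proof: both sides are the dual sums of §1; the dual weights `∏_a I_{n_a}(J_a)` are nonnegative for
`J ≥ 0` and the phases `∏_a u_a^{n_a}` have modulus one — i.e. `u ↦ ∫ χ₀ w_{J,u}` is a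
positive-definite function on `U(1)^ι`, bounded by its value at the identity.
[cite: Ginibre1970, §2 Examples 2 and 4 (positive-definite functions on a compact abelian group; bounded by the value at the identity, p. 318) with Model 3 (plane rotators)] -/
theorem norm_integral_coe_char_mul_phasedWeight_le (μ : Measure Ω) [μ.IsHaarMeasure]
    [IsProbabilityMeasure μ] (χ : ι → Ω →ₜ* Circle) {J : ι → ℝ} (hJ : ∀ a, 0 ≤ J a)
    (u : ι → Circle) (χ₀ : Ω →ₜ* Circle) :
    ‖∫ θ, ((χ₀ θ : Circle) : ℂ) *
        (Real.exp (∑ a, J a * ((u a : ℂ) * ((χ a θ : Circle) : ℂ)).re) : ℂ) ∂μ‖ ≤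
      ∫ θ, reChar χ₀ θ * ginibreWeight χ J θ ∂μ := by
  rw [integral_coe_char_mul_phasedWeight, integral_reChar_mul_ginibreWeight]
  -- the dual weights with phases and their moduli
  set f : (ι → ℤ) → ℂ := fun n => if twistChar χ χ₀ n = 1 then
      ∏ a, (besselI (n a) (J a) : ℂ) * (u a : ℂ) ^ (n a) else 0 with hf
  set g : (ι → ℤ) → ℝ := fun n => if twistChar χ χ₀ n = 1 then
      ∏ a, besselI (n a) (J a) else 0 with hg
  have hprod : ∀ n : ι → ℤ, ∏ a, ‖(besselI (n a) (J a) : ℂ) * (u a : ℂ) ^ (n a)‖ =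
      ∏ a, besselI (n a) (J a) := fun n =>
    Finset.prod_congr rfl fun a _ => by
      rw [norm_besselI_mul_phase_zpow, abs_of_nonneg (besselI_nonneg (hJ a) _)]
  have hS : Summable fun n : ι → ℤ => ∏ a, besselI (n a) (J a) := by
    have h := summable_prod_norm (c := fun a m => (besselI m (J a) : ℂ) * (u a : ℂ) ^ m)
      fun a => summable_norm_besselI_mul_phase_zpow (J a) (u a)
    simp_rw [hprod] at h
    exact h
  have hg0 : ∀ n, 0 ≤ g n := fun n => by
    simp only [hg]
    split_ifs
    · exact prod_besselI_nonneg hJ n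
    · exact le_rfl
  have hgle : ∀ n, g n ≤ ∏ a, besselI (n a) (J a) := fun n => by
    simp only [hg]
    split_ifs
    · exact le_rfl
    · exact prod_besselI_nonneg hJ n
  have hgS : Summable g := Summable.of_nonneg_of_le hg0 hgle hS
  have hle : ∀ n, ‖f n‖ ≤ g n := fun n => by
    simp only [hf, hg]
    split_ifs
    · rw [norm_prod, hprod]
    · rw [norm_zero]
  have hfS : Summable fun n => ‖f n‖ := Summable.of_nonneg_of_le (fun n => norm_nonneg _) hle hgS
  exact (norm_tsum_le_tsum_norm hfS).trans (Summable.tsum_le_tsum hle hfS hgS)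

/-- **Ginibre's twist inequality for partition functions**: for ferromagnetic couplings `J ≥ 0` and
all phases `u ∈ U(1)^ι`, `∫ exp(∑_a J_a Re(u_a χ_a(θ))) dθ ≤ ∫ exp(∑_a J_a Re χ_a(θ)) dθ` — phases
(twists, quenched bond disorder) never raise the partition function of a ferromagnetic generalised
plane rotator. [cite: Ginibre1970, §2 Examples 2 and 4 (positive-definite functions on a compact abelian group; bounded by the value at the identity, p. 318) with Model 3 (plane rotators)] -/
theorem integral_phasedWeight_le (μ : Measure Ω) [μ.IsHaarMeasure] [IsProbabilityMeasure μ]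
    (χ : ι → Ω →ₜ* Circle) {J : ι → ℝ} (hJ : ∀ a, 0 ≤ J a) (u : ι → Circle) :
    ∫ θ, Real.exp (∑ a, J a * ((u a : ℂ) * ((χ a θ : Circle) : ℂ)).re) ∂μ ≤
      ∫ θ, ginibreWeight χ J θ ∂μ := by
  have h := norm_integral_coe_char_mul_phasedWeight_le μ χ hJ u 1
  have hl : ∫ θ, (((1 : Ω →ₜ* Circle) θ : Circle) : ℂ) *
      (Real.exp (∑ a, J a * ((u a : ℂ) * ((χ a θ : Circle) : ℂ)).re) : ℂ) ∂μ =
      ((∫ θ, Real.exp (∑ a, J a * ((u a : ℂ) * ((χ a θ : Circle) : ℂ)).re) ∂μ : ℝ) : ℂ) := by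
    rw [← integral_complex_ofReal]
    refine integral_congr_ae (ae_of_all _ fun θ => ?_)
    simp
  have hr : ∫ θ, reChar (1 : Ω →ₜ* Circle) θ * ginibreWeight χ J θ ∂μ = ∫ θ, ginibreWeight χ J θ ∂μ := by
    refine integral_congr_ae (ae_of_all _ fun θ => ?_)
    simp [reChar]
  rw [hl, hr, Complex.norm_real, Real.norm_eq_abs] at h
  exact (le_abs_self _).trans h

open Classical in
/-- **Griffiths' first inequality from the dual representation**: for ferromagnetic couplings `J ≥ 0`
and every character `χ₀` of ANY compact abelian group, `0 ≤ ∫ Re χ₀(θ) exp(∑_a J_a Re χ_a(θ)) dθ` —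
the dual sum `∑_n [χ₀ ∏_a χ_a^{n_a} = 1] ∏_a I_{n_a}(J_a)` has nonnegative terms (no square-root
hypothesis on the group is needed). [cite: Ginibre1970, Prop. 3 with §2 Example 4 and Model 3 (plane rotators: Griffiths' first inequality)] -/
theorem integral_reChar_mul_ginibreWeight_nonneg (μ : Measure Ω) [μ.IsHaarMeasure]
    [IsProbabilityMeasure μ] (χ : ι → Ω →ₜ* Circle) {J : ι → ℝ} (hJ : ∀ a, 0 ≤ J a)
    (χ₀ : Ω →ₜ* Circle) : 0 ≤ ∫ θ, reChar χ₀ θ * ginibreWeight χ J θ ∂μ := by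
  rw [integral_reChar_mul_ginibreWeight]
  refine tsum_nonneg fun n => ?_
  split_ifs
  · exact prod_besselI_nonneg hJ n
  · exact le_rfl

/-- **Griffiths' first inequality** `0 ≤ ⟨Re χ₀⟩_J` for a Ginibre model with ferromagnetic couplings
`J ≥ 0` on any compact abelian group (dual representation; companion of the tree's
`torus_ginibreExpect_reChar_nonneg`, which assumes square roots in the group).
[cite: Ginibre1970, Prop. 3 with §2 Example 4 and Model 3 (plane rotators: Griffiths' first inequality)] -/
theorem ginibreExpect_reChar_nonneg_dual (μ : Measure Ω) [μ.IsHaarMeasure]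
    [IsProbabilityMeasure μ] (χ : ι → Ω →ₜ* Circle) {J : ι → ℝ} (hJ : ∀ a, 0 ≤ J a)
    (χ₀ : Ω →ₜ* Circle) : 0 ≤ ginibreExpect μ χ J (reChar χ₀) := by
  rw [ginibreExpect]
  refine div_nonneg (integral_reChar_mul_ginibreWeight_nonneg μ χ hJ χ₀) ?_
  have h := integral_reChar_mul_ginibreWeight_nonneg μ χ hJ 1
  refine le_of_le_of_eq h (integral_congr_ae (ae_of_all _ fun θ => ?_))
  simp [reChar]

end Phased

/-! ## §3 The torus `U(1)^V`: bond phases, twists -/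

namespace BondSystem

variable {V ι : Type*} (G : BondSystem V ι)

section Weights

variable [Fintype ι]

/-- The Garban–Spencer weight with bond phases is a phased Ginibre weight of the bond characters:
`w_{β,u}(θ) = exp(∑_a β Re(u_a χ_a(θ)))`. [cite: GarbanSpencer2022, (1.3) (bond phases)] -/
theorem weight_eq_exp_sum_phase (β : ℝ) (u : ι → Circle) (θ : V → Circle) :
    G.weight β u θ = Real.exp (∑ a, β * ((u a : ℂ) * ((G.bondChar a θ : Circle) : ℂ)).re) := by
  rw [weight, energy, Finset.mul_sum]
  congr 1
  refine Finset.sum_congr rfl fun a _ => ?_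
  rw [G.bondVar_eq_mul_bondChar, Circle.coe_mul]

/-- The Fisher–Barber–Jasnow twisted weight is a phased Ginibre weight of the bond characters with the
phases `u_a = e^{i t s_a}`: `e^{H_t(θ)} = exp(∑_a J_a Re(e^{its_a} χ_a(θ)))`. [cite: FisherBarberJasnow1973, §II eqs. (2.3)–(2.5) (twisted ensemble)] -/
theorem twistWeight_eq_exp_sum_phase (J s : ι → ℝ) (t : ℝ) (θ : V → Circle) :
    G.twistWeight J s t θ =
      Real.exp (∑ a, J a * (((twistPhases s t a : Circle) : ℂ) * ((G.bondChar a θ : Circle) : ℂ)).re) := by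
  rw [twistWeight, twistHamiltonian]
  congr 1
  refine Finset.sum_congr rfl fun a _ => ?_
  rw [twistPhases, Circle.coe_exp, Complex.mul_re, Complex.exp_ofReal_mul_I_re,
    Complex.exp_ofReal_mul_I_im]
  rfl

end Weights

section PartitionFn

variable [Fintype V] [Fintype ι] [MeasurableSpace Circle] [BorelSpace Circle]

/-- Ginibre's twist inequality on the torus `U(1)^V`: for ferromagnetic bond couplings `J ≥ 0` and
all bond phases `u`, `∫ exp(∑_a J_a Re(u_a χ_a(θ))) dθ ≤ Z(J)`. [cite: Ginibre1970, §2 Examples 2 and 4 with Model 3 (plane rotators)] -/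
theorem integral_exp_sum_phase_le_partitionFnJ {J : ι → ℝ} (hJ : ∀ a, 0 ≤ J a) (u : ι → Circle) :
    ∫ θ, Real.exp (∑ a, J a * ((u a : ℂ) * ((G.bondChar a θ : Circle) : ℂ)).re) ∂torusHaar V ≤
      G.partitionFnJ J :=
  integral_phasedWeight_le (torusHaar V) G.bondChar hJ u

/-- **Quenched bond phases never raise the partition function** of the ferromagnetic XY model:
`Z_{β,u} ≤ Z_{β,1}` for `β ≥ 0` and every `u ∈ U(1)^ι` (the partition-function companion of the
Messager–Miracle-Solé–Pfister comparison `⟨cos(θ_x − θ_y)⟩_u ≤ ⟨cos(θ_x − θ_y)⟩_1` of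
`MMPInequality.lean`). [cite: Ginibre1970, §2 Examples 2 and 4 with Model 3 (plane rotators); GarbanSpencer2022 (1.3)–(1.4) (bond phases)] -/
theorem partitionFn_le_partitionFn_one {β : ℝ} (hβ : 0 ≤ β) (u : ι → Circle) :
    G.partitionFn β u ≤ G.partitionFn β 1 := by
  rw [partitionFn_one_eq_partitionFnJ, partitionFn]
  have h := G.integral_exp_sum_phase_le_partitionFnJ (J := fun _ => β) (fun _ => hβ) u
  refine le_of_eq_of_le (integral_congr_ae (ae_of_all _ fun θ => ?_)) h
  exact G.weight_eq_exp_sum_phase β u θ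

/-- **A twist costs free energy**: `Z(t) ≤ Z(J) = Z(0)` for the twisted ferromagnetic (`J ≥ 0`) plane
rotator, every twist profile `s` and amplitude `t`. [cite: Ginibre1970, §2 Examples 2 and 4 with Model 3 (plane rotators); FisherBarberJasnow1973 §II eqs. (2.3)–(2.5) (twisted ensemble)] -/
theorem twistPartitionFn_le {J : ι → ℝ} (hJ : ∀ a, 0 ≤ J a) (s : ι → ℝ) (t : ℝ) :
    G.twistPartitionFn J s t ≤ G.partitionFnJ J := by
  have h := G.integral_exp_sum_phase_le_partitionFnJ hJ (twistPhases s t)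
  refine le_of_eq_of_le (integral_congr_ae (ae_of_all _ fun θ => ?_)) h
  exact G.twistWeight_eq_exp_sum_phase J s t θ

/-- The same with `Z(0)` on the right: `Z(t) ≤ Z(0)`, i.e. `t = 0` is a global maximum of the twisted
partition function. [cite: Ginibre1970, §2 Examples 2 and 4 with Model 3 (plane rotators); FisherBarberJasnow1973 §II eqs. (2.3)–(2.5) (twisted ensemble)] -/
theorem twistPartitionFn_le_zero {J : ι → ℝ} (hJ : ∀ a, 0 ≤ J a) (s : ι → ℝ) (t : ℝ) :
    G.twistPartitionFn J s t ≤ G.twistPartitionFn J s 0 := by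
  rw [twistPartitionFn_zero]
  exact G.twistPartitionFn_le hJ s t

/-- In free-energy form: `log Z(t) ≤ log Z(0)`, i.e. the twisted free energy `−log Z(t)` is minimal
at zero twist. [cite: FisherBarberJasnow1973, §II eqs. (2.3)–(2.5) (twist free-energy increment); Ginibre1970 §2 Examples 2 and 4] -/
theorem log_twistPartitionFn_le {J : ι → ℝ} (hJ : ∀ a, 0 ≤ J a) (s : ι → ℝ) (t : ℝ) :
    Real.log (G.twistPartitionFn J s t) ≤ Real.log (G.twistPartitionFn J s 0) :=
  Real.log_le_log (G.twistPartitionFn_pos J s t) (G.twistPartitionFn_le_zero hJ s t)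

open Classical in
/-- **The twisted partition function in the dual variables**: `Z(t) = ∑_{n ∈ ℤ^ι closed}
∏_a I_{n_a}(J_a) e^{i t s_a n_a}` — the sum over divergence-free integer bond currents `n`
(`∏_a χ_a^{n_a} = 1`), each current picking up the phase `e^{it ∑_a s_a n_a}` of the twist (complex
form; any real couplings). [cite: FrohlichSpencerCMP1982, §2.3 (duality transformation); FisherBarberJasnow1973 §II eqs. (2.3)–(2.5)] -/
theorem coe_twistPartitionFn_eq_tsum (J s : ι → ℝ) (t : ℝ) :
    ((G.twistPartitionFn J s t : ℝ) : ℂ) =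
      ∑' n : ι → ℤ, if twistChar G.bondChar 1 n = 1 then
        ∏ a, (besselI (n a) (J a) : ℂ) * ((twistPhases s t a : Circle) : ℂ) ^ (n a) else 0 := by
  rw [← coe_integral_phasedWeight_eq_tsum (torusHaar V) G.bondChar J (twistPhases s t),
    twistPartitionFn]
  congr 1
  exact integral_congr_ae (ae_of_all _ fun θ => G.twistWeight_eq_exp_sum_phase J s t θ)

/-- **Griffiths' first inequality for the plane rotator with general ferromagnetic couplings**:
`0 ≤ ⟨Re χ₀⟩_J` for every character `χ₀` of `U(1)^V` (e.g. `cos(∑_x m_x θ_x)`) and `J ≥ 0`.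
[cite: Ginibre1970, Prop. 3 with §2 Example 4 and Model 3 (plane rotators: Griffiths' first inequality)] -/
theorem expectJ_reChar_nonneg {J : ι → ℝ} (hJ : ∀ a, 0 ≤ J a) (χ₀ : (V → Circle) →ₜ* Circle) :
    0 ≤ G.expectJ J (reChar χ₀) :=
  ginibreExpect_reChar_nonneg_dual (torusHaar V) G.bondChar hJ χ₀

/-- `∫ 𝒥_s w_J dθ = 0`: the unnormalised mean twist current vanishes (tree
`expectJ_twistCurrent_eq_zero`). [cite: Thijssen2007, eq. (15.97) (periodic boundary conditions; current terms)] -/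
theorem integral_twistCurrent_mul_weightJ (J s : ι → ℝ) :
    ∫ θ, G.twistCurrent J s θ * G.weightJ J θ ∂torusHaar V = 0 := by
  have h := G.expectJ_twistCurrent_eq_zero J s
  rw [expectJ_eq, div_eq_zero_iff] at h
  exact h.resolve_right (G.partitionFnJ_pos J).ne'

/-! ## §4 Finite twists: `0 ≤ log Z(0) − log Z(t) ≤ ∑_a J_a (1 − cos(t s_a)) ⟨cos ∇θ_a⟩_J` -/

/-- **Jensen / classical Peierls–Bogoliubov in the plane-rotator state**: for every continuous
observable `X`, `e^{⟨X⟩_J} · Z(J) ≤ ∫ e^{X} w_J` (supporting line of `exp` at the mean; any real `J`).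
[cite: FriedliVelenik2017, §3.10.2, proof of Thm 3.53 (Jensen: Z ≥ Z⁰·exp(−⟨H¹⟩⁰))] -/
theorem exp_expectJ_mul_partitionFnJ_le (J : ι → ℝ) {X : (V → Circle) → ℝ} (hX : Continuous X) :
    Real.exp (G.expectJ J X) * G.partitionFnJ J ≤
      ∫ θ, Real.exp (X θ) * G.weightJ J θ ∂torusHaar V := by
  set m : ℝ := G.expectJ J X with hm
  have hZ := G.partitionFnJ_pos J
  have hw := G.continuous_weightJ J
  have hmean : m * G.partitionFnJ J = ∫ θ, X θ * G.weightJ J θ ∂torusHaar V := by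
    rw [hm, expectJ_eq, div_mul_cancel₀ _ hZ.ne']
  have hline : ∀ θ, Real.exp m * ((1 + (X θ - m)) * G.weightJ J θ) ≤
      Real.exp (X θ) * G.weightJ J θ := fun θ => by
    rw [← mul_assoc]
    refine mul_le_mul_of_nonneg_right ?_ (G.weightJ_pos J θ).le
    have h1 : X θ - m + 1 ≤ Real.exp (X θ - m) := Real.add_one_le_exp _
    have h2 : Real.exp m * Real.exp (X θ - m) = Real.exp (X θ) := by
      rw [← Real.exp_add]; congr 1; ring
    rw [← h2]
    exact mul_le_mul_of_nonneg_left (by linarith) (Real.exp_pos _).le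
  have hi1 : Integrable (fun θ => (1 + (X θ - m)) * G.weightJ J θ) (torusHaar V) :=
    integrable_torusHaar_of_continuous ((continuous_const.add (hX.sub continuous_const)).mul hw)
  have hi2 : Integrable (fun θ => Real.exp (X θ) * G.weightJ J θ) (torusHaar V) :=
    integrable_torusHaar_of_continuous ((Real.continuous_exp.comp hX).mul hw)
  have hi3 : Integrable (fun θ => X θ * G.weightJ J θ) (torusHaar V) :=
    integrable_torusHaar_of_continuous (hX.mul hw)
  have hint := integral_mono (hi1.const_mul (Real.exp m)) hi2 hline
  have hsplit : ∫ θ, (1 + (X θ - m)) * G.weightJ J θ ∂torusHaar V = G.partitionFnJ J := by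
    have : (fun θ => (1 + (X θ - m)) * G.weightJ J θ) =
        fun θ => (1 - m) * G.weightJ J θ + X θ * G.weightJ J θ := funext fun θ => by ring
    rw [this, integral_add ((G.integrable_weightJ J).const_mul _) hi3, integral_const_mul, ← hmean,
      partitionFnJ]
    ring
  rw [integral_const_mul, hsplit] at hint
  exact hint

omit [Fintype V] [MeasurableSpace Circle] [BorelSpace Circle] in
/-- The twisted weight over the untwisted one: `e^{H_t(θ)} = e^{X_t(θ)} w_J(θ)` with
`X_t = ∑_a J_a ((cos(t s_a) − 1) Re χ_a − sin(t s_a) Im χ_a) = H_t − H_0`. [cite: FisherBarberJasnow1973, §II eqs. (2.3)–(2.5) (twisted ensemble)] -/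
theorem twistWeight_eq_exp_mul_weightJ (J s : ι → ℝ) (t : ℝ) (θ : V → Circle) :
    G.twistWeight J s t θ =
      Real.exp (∑ a, J a * ((Real.cos (t * s a) - 1) * reChar (G.bondChar a) θ -
          Real.sin (t * s a) * imChar (G.bondChar a) θ)) * G.weightJ J θ := by
  rw [twistWeight, twistHamiltonian, weightJ, ginibreWeight, ginibreHamiltonian, ← Real.exp_add,
    ← Finset.sum_add_distrib]
  congr 1
  exact Finset.sum_congr rfl fun a _ => by ring

/-- The mean of `X_t = H_t − H_0` in the untwisted state:
`⟨X_t⟩_J = −∑_a J_a (1 − cos(t s_a)) ⟨Re χ_a⟩_J` (the `sin` terms average to zero, `⟨𝒥⟩ = 0`).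
[cite: FisherBarberJasnow1973, §II eqs. (2.3)–(2.5) (twisted ensemble)] -/
theorem expectJ_twistHamiltonian_sub (J s : ι → ℝ) (t : ℝ) :
    G.expectJ J (fun θ => ∑ a, J a * ((Real.cos (t * s a) - 1) * reChar (G.bondChar a) θ -
        Real.sin (t * s a) * imChar (G.bondChar a) θ)) =
      -∑ a, J a * (1 - Real.cos (t * s a)) * G.expectJ J (reChar (G.bondChar a)) := by
  have hZ := G.partitionFnJ_pos J
  have hw := G.continuous_weightJ J
  -- split the observable: `X_t = ∑_a c_a Re χ_a − 𝒥'`, `𝒥' = twistCurrent J (sin(t s ·))`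
  have hX : ∀ θ, (∑ a, J a * ((Real.cos (t * s a) - 1) * reChar (G.bondChar a) θ -
        Real.sin (t * s a) * imChar (G.bondChar a) θ)) =
      (∑ a, J a * (Real.cos (t * s a) - 1) * reChar (G.bondChar a) θ) -
        G.twistCurrent J (fun a => Real.sin (t * s a)) θ := fun θ => by
    rw [twistCurrent, ← Finset.sum_sub_distrib]
    exact Finset.sum_congr rfl fun a _ => by ring
  have hi : ∀ a, Integrable (fun θ => reChar (G.bondChar a) θ * G.weightJ J θ) (torusHaar V) :=
    fun a => integrable_torusHaar_of_continuous ((continuous_reChar _).mul hw)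
  have hiS : Integrable (fun θ => (∑ a, J a * (Real.cos (t * s a) - 1) * reChar (G.bondChar a) θ) *
      G.weightJ J θ) (torusHaar V) :=
    integrable_torusHaar_of_continuous ((continuous_finsetSum _ fun a _ =>
      continuous_const.mul (continuous_reChar _)).mul hw)
  have hiJ : Integrable (fun θ => G.twistCurrent J (fun a => Real.sin (t * s a)) θ * G.weightJ J θ)
      (torusHaar V) :=
    integrable_torusHaar_of_continuous ((G.continuous_twistCurrent J _).mul hw)
  have hsm : ∀ θ, (∑ a, J a * (Real.cos (t * s a) - 1) * reChar (G.bondChar a) θ) * G.weightJ J θ =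
      ∑ a, (J a * (Real.cos (t * s a) - 1)) * (reChar (G.bondChar a) θ * G.weightJ J θ) := fun θ => by
    rw [Finset.sum_mul]
    exact Finset.sum_congr rfl fun a _ => by ring
  rw [expectJ_eq]
  simp_rw [hX, sub_mul]
  rw [integral_sub hiS hiJ, integral_twistCurrent_mul_weightJ, sub_zero]
  simp_rw [hsm]
  rw [integral_finsetSum _ fun a _ => (hi a).const_mul _]
  simp_rw [integral_const_mul]
  rw [Finset.sum_div, ← Finset.sum_neg_distrib]
  refine Finset.sum_congr rfl fun a _ => ?_
  rw [expectJ_eq]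
  ring

/-- **Jensen's lower bound on the twisted partition function** (any real couplings):
`Z(J) · exp(−∑_a J_a (1 − cos(t s_a)) ⟨cos ∇θ_a⟩_J) ≤ Z(t)`. [cite: FriedliVelenik2017, §3.10.2, proof of Thm 3.53 (Jensen); FisherBarberJasnow1973 §II eqs. (2.3)–(2.5)] -/
theorem partitionFnJ_mul_exp_le_twistPartitionFn (J s : ι → ℝ) (t : ℝ) :
    G.partitionFnJ J * Real.exp (-∑ a, J a * (1 - Real.cos (t * s a)) *
        G.expectJ J (reChar (G.bondChar a))) ≤ G.twistPartitionFn J s t := by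
  have hXc : Continuous fun θ : V → Circle => ∑ a, J a * ((Real.cos (t * s a) - 1) *
      reChar (G.bondChar a) θ - Real.sin (t * s a) * imChar (G.bondChar a) θ) :=
    continuous_finsetSum _ fun a _ => continuous_const.mul
      ((continuous_const.mul (continuous_reChar _)).sub (continuous_const.mul (continuous_imChar _)))
  have h := G.exp_expectJ_mul_partitionFnJ_le J hXc
  rw [expectJ_twistHamiltonian_sub, mul_comm] at h
  refine h.trans (le_of_eq ?_)
  rw [twistPartitionFn]
  exact integral_congr_ae (ae_of_all _ fun θ => (G.twistWeight_eq_exp_mul_weightJ J s t θ).symm)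

/-- **The free-energy cost of a finite twist is at most the twist-weighted bond energy**:
`log Z(0) − log Z(t) ≤ ∑_a J_a (1 − cos(t s_a)) ⟨cos ∇θ_a⟩_J` (any real couplings; `Z(0) = Z(J)`).
[cite: FisherBarberJasnow1973, §II eqs. (2.3)–(2.5) (twist free-energy increment); FriedliVelenik2017 §3.10.2 (Jensen)] -/
theorem log_twistPartitionFn_zero_sub_le (J s : ι → ℝ) (t : ℝ) :
    Real.log (G.twistPartitionFn J s 0) - Real.log (G.twistPartitionFn J s t) ≤
      ∑ a, J a * (1 - Real.cos (t * s a)) * G.expectJ J (reChar (G.bondChar a)) := by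
  have hZ := G.partitionFnJ_pos J
  have hZt := G.twistPartitionFn_pos J s t
  have h := Real.log_le_log (mul_pos hZ (Real.exp_pos _))
    (G.partitionFnJ_mul_exp_le_twistPartitionFn J s t)
  rw [Real.log_mul hZ.ne' (Real.exp_pos _).ne', Real.log_exp] at h
  rw [twistPartitionFn_zero]
  linarith

/-- `1 − cos x ≤ x²/2`, hence `∑_a J_a (1 − cos(t s_a)) ⟨cos ∇θ_a⟩_J ≤ (t²/2) ∑_a J_a s_a² ⟨cos ∇θ_a⟩_J`
for `J ≥ 0` (Griffiths: `⟨cos ∇θ_a⟩_J ≥ 0`). [cite: FisherBarberJasnow1973, §II eqs. (2.4)–(2.5) (quadratic twist response)] -/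
theorem sum_one_sub_cos_mul_expectJ_le {J : ι → ℝ} (hJ : ∀ a, 0 ≤ J a) (s : ι → ℝ) (t : ℝ) :
    ∑ a, J a * (1 - Real.cos (t * s a)) * G.expectJ J (reChar (G.bondChar a)) ≤
      t ^ 2 / 2 * ∑ a, J a * s a ^ 2 * G.expectJ J (reChar (G.bondChar a)) := by
  rw [Finset.mul_sum]
  refine Finset.sum_le_sum fun a _ => ?_
  have hc : 1 - Real.cos (t * s a) ≤ (t * s a) ^ 2 / 2 := by
    have := Real.one_sub_sq_div_two_le_cos (x := t * s a); linarith
  have hE := G.expectJ_reChar_nonneg hJ (G.bondChar a)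
  have hJE : 0 ≤ J a * G.expectJ J (reChar (G.bondChar a)) := mul_nonneg (hJ a) hE
  calc J a * (1 - Real.cos (t * s a)) * G.expectJ J (reChar (G.bondChar a))
      = (1 - Real.cos (t * s a)) * (J a * G.expectJ J (reChar (G.bondChar a))) := by ring
    _ ≤ (t * s a) ^ 2 / 2 * (J a * G.expectJ J (reChar (G.bondChar a))) :=
        mul_le_mul_of_nonneg_right hc hJE
    _ = t ^ 2 / 2 * (J a * s a ^ 2 * G.expectJ J (reChar (G.bondChar a))) := by ring

/-- **The finite-twist free-energy window**: for ferromagnetic couplings `J ≥ 0`, every twist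
profile `s` and amplitude `t`,
`0 ≤ log Z(0) − log Z(t) ≤ (t²/2) ∑_a J_a s_a² ⟨cos(θ_{tgt a} − θ_{src a})⟩_J`
— Ginibre's twist inequality below, Jensen and the f-sum above: the GLOBAL version of
`0 ≤ twistModulus ≤ ∑_a J_a s_a² ⟨cos ∇θ_a⟩_J`. [cite: FisherBarberJasnow1973, §II eqs. (2.3)–(2.5) (twist free-energy increment ½Υt²); Ginibre1970 §2 Examples 2 and 4] -/
theorem log_twistPartitionFn_zero_sub_mem_Icc {J : ι → ℝ} (hJ : ∀ a, 0 ≤ J a) (s : ι → ℝ) (t : ℝ) :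
    Real.log (G.twistPartitionFn J s 0) - Real.log (G.twistPartitionFn J s t) ∈
      Set.Icc 0 (t ^ 2 / 2 * ∑ a, J a * s a ^ 2 * G.expectJ J (reChar (G.bondChar a))) :=
  ⟨sub_nonneg.2 (G.log_twistPartitionFn_le hJ s t),
    (G.log_twistPartitionFn_zero_sub_le J s t).trans (G.sum_one_sub_cos_mul_expectJ_le hJ s t)⟩

/-- The twisted partition function is even in the twist: `Z(−t) = Z(t)` (inversion `θ ↦ θ̄` of the
Haar measure; any real couplings). [cite: FisherBarberJasnow1973, §II eqs. (2.3)–(2.5) (twisted ensemble)] -/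
theorem twistPartitionFn_neg (J s : ι → ℝ) (t : ℝ) :
    G.twistPartitionFn J s (-t) = G.twistPartitionFn J s t := by
  haveI : (torusHaar V).IsInvInvariant := by unfold torusHaar; infer_instance
  rw [twistPartitionFn, twistPartitionFn, ← integral_inv_eq_self (fun θ => G.twistWeight J s t θ) (torusHaar V)]
  refine integral_congr_ae (ae_of_all _ fun θ => ?_)
  simp only [twistWeight, twistHamiltonian]
  congr 1
  refine Finset.sum_congr rfl fun a _ => ?_
  have hre : reChar (G.bondChar a) θ⁻¹ = reChar (G.bondChar a) θ := by
    simp [reChar, map_inv]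
  have him : imChar (G.bondChar a) θ⁻¹ = -imChar (G.bondChar a) θ := by
    simp [imChar, map_inv]
  rw [hre, him, neg_mul, Real.cos_neg, Real.sin_neg]
  ring

/-! ## §5 The helicity modulus is nonnegative -/

/-- `Z'(0) = 0`. [cite: FisherBarberJasnow1973, §II eqs. (2.3)–(2.5) (no term linear in the twist)] -/
theorem twistPartitionFnDeriv_zero_eq_zero (J s : ι → ℝ) : G.twistPartitionFnDeriv J s 0 = 0 := by
  rw [twistPartitionFnDeriv_zero, integral_twistCurrent_mul_weightJ, neg_zero]

/-- `(−log Z)'(0) = 0`. [cite: FisherBarberJasnow1973, §II eqs. (2.3)–(2.5) (no term linear in the twist)] -/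
theorem twistFreeEnergyDeriv_zero (J s : ι → ℝ) : G.twistFreeEnergyDeriv J s 0 = 0 := by
  rw [twistFreeEnergyDeriv, twistPartitionFnDeriv_zero_eq_zero, neg_zero, zero_div]

/-- **The helicity modulus of a ferromagnetic plane rotator is nonnegative**:
`0 ≤ twistModulus G J s = (−log Z)''(0)` for `J ≥ 0` and every twist profile `s`. Proof: `t = 0` is a
global minimum of `F(t) = −log Z(t)` (Ginibre's twist inequality) with `F'(0) = 0` and
`F''(0) = twistModulus`; were `F''(0) < 0`, the second-derivative test would make `0` a local
maximum as well, so `F` would be locally constant at `0` and `F''(0) = 0` — a contradiction.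
[cite: FisherBarberJasnow1973, §II eqs. (2.4)–(2.5) (helicity modulus as the twist response); Ginibre1970 §2 Examples 2 and 4 (the twist inequality)] -/
theorem twistModulus_nonneg {J : ι → ℝ} (hJ : ∀ a, 0 ≤ J a) (s : ι → ℝ) :
    0 ≤ G.twistModulus J s := by
  by_contra hneg
  rw [not_le] at hneg
  set F : ℝ → ℝ := fun t => -Real.log (G.twistPartitionFn J s t) with hF
  have hd1 : deriv F = G.twistFreeEnergyDeriv J s := G.deriv_negLog_twistPartitionFn J s
  have hd2 : deriv (deriv F) 0 = G.twistModulus J s := by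
    rw [hd1]
    exact (G.hasDerivAt_twistFreeEnergyDeriv_zero J s).deriv
  have hmin : ∀ t, F 0 ≤ F t := fun t => by
    simp only [hF]
    exact neg_le_neg (G.log_twistPartitionFn_le hJ s t)
  have hcont : ContinuousAt F 0 := (G.hasDerivAt_negLog_twistPartitionFn J s 0).continuousAt
  have hloc : IsLocalMax F 0 :=
    isLocalMax_of_deriv_deriv_neg (by rw [hd2]; exact hneg)
      (by rw [hd1]; exact G.twistFreeEnergyDeriv_zero J s) hcont
  have hev : F =ᶠ[𝓝 0] fun _ => F 0 :=
    hloc.mono fun t ht => le_antisymm ht (hmin t)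
  have hd0 : deriv (deriv F) 0 = 0 := by
    rw [hev.deriv.deriv_eq]
    simp
  rw [hd2] at hd0
  exact hneg.ne hd0

/-- **Current fluctuations never exceed the f-sum**: `⟨𝒥_s²⟩_J ≤ ∑_a J_a s_a² ⟨cos(θ_{tgt a} − θ_{src a})⟩_J`
for `J ≥ 0` (`twistModulus = ∑ J s² ⟨cos⟩ − ⟨𝒥_s²⟩ ≥ 0`). [cite: FisherBarberJasnow1973, §II eqs. (2.4)–(2.5) (helicity modulus); Thijssen2007 eq. (15.97)] -/
theorem expectJ_twistCurrent_sq_le_energy {J : ι → ℝ} (hJ : ∀ a, 0 ≤ J a) (s : ι → ℝ) :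
    G.expectJ J (fun θ => G.twistCurrent J s θ ^ 2) ≤
      ∑ a, J a * s a ^ 2 * G.expectJ J (reChar (G.bondChar a)) := by
  have h0 := G.twistModulus_nonneg hJ s
  rw [twistModulus_eq] at h0
  linarith

/-- The two-sided window `0 ≤ (−log Z)''(0) ≤ ∑_a J_a s_a²` for `J ≥ 0`. [cite: FisherBarberJasnow1973, §II eqs. (2.4)–(2.5) (helicity modulus); Ginibre1970 §2 Examples 2 and 4] -/
theorem twistModulus_mem_Icc {J : ι → ℝ} (hJ : ∀ a, 0 ≤ J a) (s : ι → ℝ) :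
    G.twistModulus J s ∈ Set.Icc 0 (∑ a, J a * s a ^ 2) :=
  ⟨G.twistModulus_nonneg hJ s, G.twistModulus_le_sum hJ s⟩

end PartitionFn

end BondSystem

/-! ## §6 The torus `(ℤ/Lℤ)²`: `0 ≤ βΥ_L(K) ≤ 8K²/(1 + 8K)` -/

section Torus

variable {L : ℕ} [NeZero L] [MeasurableSpace Circle] [BorelSpace Circle]

/-- **`0 ≤ βΥ_L(K)`** for `K ≥ 0`: the reduced helicity modulus of the nearest-neighbour plane rotator
on `(ℤ/Lℤ)²` is nonnegative in every volume. [cite: FisherBarberJasnow1973, §II eqs. (2.4)–(2.5) (helicity modulus); Ginibre1970 §2 Examples 2 and 4] -/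
theorem torusXYStiffness_nonneg {K : ℝ} (hK : 0 ≤ K) : 0 ≤ torusXYStiffness L K :=
  div_nonneg ((torusXY 2 L).twistModulus_nonneg (fun _ => hK) _) (Nat.cast_nonneg _)

/-- **The stiffness window `0 ≤ βΥ_L(K) ≤ 8K²/(1 + 8K)`** for every `L ≥ 3` and `K > 0` (floor: this
file; ceiling: the tree's `torusXYStiffness_le`, f-sum × equipartition). Uniform in the volume.
[cite: FisherBarberJasnow1973, §II eqs. (2.4)–(2.5) (helicity modulus); AizenmanSimon1980LocalWard eq. (2.4) (equipartition input)] -/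
theorem torusXYStiffness_mem_Icc (hL : 3 ≤ L) {K : ℝ} (hK : 0 < K) :
    torusXYStiffness L K ∈ Set.Icc 0 (8 * K ^ 2 / (1 + 8 * K)) :=
  ⟨torusXYStiffness_nonneg hK.le, torusXYStiffness_le hL hK⟩

/-- `βΥ_L(K) ∈ [0, K]` for `K ≥ 0` (any `L ≥ 1`). [cite: FisherBarberJasnow1973, §II eqs. (2.4)–(2.5) (helicity modulus); Ginibre1970 §2 Examples 2 and 4] -/
theorem torusXYStiffness_mem_Icc_coupling {K : ℝ} (hK : 0 ≤ K) :
    torusXYStiffness L K ∈ Set.Icc 0 K :=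
  ⟨torusXYStiffness_nonneg hK, torusXYStiffness_le_coupling hK⟩

/-- In temperature units, `K = J/T`: **`0 ≤ Υ_L(T) ≤ 8J²/(T + 8J)`** for every `L ≥ 3` (`J > 0` the
coupling, `T > 0` the temperature, `Υ_L(T) = T·βΥ_L`). [cite: FisherBarberJasnow1973, §II eqs. (2.4)–(2.5) (helicity modulus); AizenmanSimon1980LocalWard eq. (2.4) (equipartition input)] -/
theorem mul_torusXYStiffness_mem_Icc (hL : 3 ≤ L) {J T : ℝ} (hJ : 0 < J) (hT : 0 < T) :
    T * torusXYStiffness L (J / T) ∈ Set.Icc 0 (8 * J ^ 2 / (T + 8 * J)) :=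
  ⟨mul_nonneg hT.le (torusXYStiffness_nonneg (div_pos hJ hT).le), mul_torusXYStiffness_le hL hJ hT⟩

/-- The twisted partition function of the torus is maximal at zero twist: `Z_L(K; t) ≤ Z_L(K; 0)` for
`K ≥ 0` (twist along `e₁`). [cite: Ginibre1970, §2 Examples 2 and 4 with Model 3 (plane rotators); FisherBarberJasnow1973 §II eqs. (2.3)–(2.5)] -/
theorem torusXY_twistPartitionFn_le {K : ℝ} (hK : 0 ≤ K) (t : ℝ) :
    (torusXY 2 L).twistPartitionFn (fun _ => K) (torusTwistProfile L) t ≤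
      (torusXY 2 L).twistPartitionFn (fun _ => K) (torusTwistProfile L) 0 :=
  (torusXY 2 L).twistPartitionFn_le_zero (fun _ => hK) _ t

omit [MeasurableSpace Circle] [BorelSpace Circle] in
/-- `∑_b s_b² = |Λ| = L²` for the twist profile along `e₁` (one `e₁`-bond per site). [cite: FisherBarberJasnow1973, §II eqs. (2.3)–(2.5) (uniform twist)] -/
theorem sum_torusTwistProfile_sq_eq_card :
    ∑ b : TorusSite 2 L × Fin 2, torusTwistProfile L b ^ 2 = Fintype.card (TorusSite 2 L) := by
  rw [Fintype.sum_prod_type]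
  have h : ∀ z : TorusSite 2 L, ∑ i : Fin 2, torusTwistProfile L (z, i) ^ 2 = 1 := fun z => by
    simp [torusTwistProfile]
  simp only [h, Finset.sum_const, Finset.card_univ, nsmul_eq_mul, mul_one]

/-- **The finite-twist free-energy window on the torus**, per site: for `L ≥ 3`, `K > 0` and every
twist `t` per lattice spacing along `e₁`,
`0 ≤ (log Z_L(K; 0) − log Z_L(K; t))/L² ≤ (t²/2) · 8K²/(1 + 8K)` — the global companion of
`0 ≤ βΥ_L(K) ≤ 8K²/(1 + 8K)` (Ginibre below; Jensen, f-sum and equipartition above).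
[cite: FisherBarberJasnow1973, §II eqs. (2.3)–(2.5) (twist free-energy increment ½Υt² per unit volume); AizenmanSimon1980LocalWard eq. (2.4) (equipartition input)] -/
theorem torusXY_log_twistPartitionFn_sub_div_card_mem_Icc (hL : 3 ≤ L) {K : ℝ} (hK : 0 < K) (t : ℝ) :
    (Real.log ((torusXY 2 L).twistPartitionFn (fun _ => K) (torusTwistProfile L) 0) -
        Real.log ((torusXY 2 L).twistPartitionFn (fun _ => K) (torusTwistProfile L) t)) /
      (Fintype.card (TorusSite 2 L) : ℝ) ∈ Set.Icc 0 (t ^ 2 / 2 * (8 * K ^ 2 / (1 + 8 * K))) := by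
  have hcard : (0 : ℝ) < Fintype.card (TorusSite 2 L) := Nat.cast_pos.2 Fintype.card_pos
  obtain ⟨h0, h1⟩ := (torusXY 2 L).log_twistPartitionFn_zero_sub_mem_Icc (J := fun _ => K)
    (fun _ => hK.le) (torusTwistProfile L) t
  refine ⟨div_nonneg h0 hcard.le, ?_⟩
  rw [div_le_iff₀ hcard]
  refine h1.trans ?_
  have hE : ∀ b, (torusXY 2 L).expectJ (fun _ => K) (reChar ((torusXY 2 L).bondChar b)) ≤
      8 * K / (1 + 8 * K) := fun b => by
    rw [torusXY_expectJ_reChar_bondChar]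
    exact torusXYBondEnergy_le hL hK b
  calc t ^ 2 / 2 * ∑ b, K * torusTwistProfile L b ^ 2 *
          (torusXY 2 L).expectJ (fun _ => K) (reChar ((torusXY 2 L).bondChar b))
      ≤ t ^ 2 / 2 * ∑ b, K * torusTwistProfile L b ^ 2 * (8 * K / (1 + 8 * K)) := by
        refine mul_le_mul_of_nonneg_left (Finset.sum_le_sum fun b _ => ?_) (by positivity)
        exact mul_le_mul_of_nonneg_left (hE b) (mul_nonneg hK.le (sq_nonneg _))
    _ = t ^ 2 / 2 * (8 * K ^ 2 / (1 + 8 * K)) * Fintype.card (TorusSite 2 L) := by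
        have hs : ∑ b, K * torusTwistProfile L b ^ 2 * (8 * K / (1 + 8 * K)) =
            K * (8 * K / (1 + 8 * K)) * ∑ b : TorusSite 2 L × Fin 2, torusTwistProfile L b ^ 2 := by
          rw [Finset.mul_sum]
          exact Finset.sum_congr rfl fun b _ => by ring
        rw [hs, sum_torusTwistProfile_sq_eq_card]
        ring

end Torus

end Literature.Probability.LatticeModels
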